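import Literature.Computability.AlgebraicComplexity.InterfaceTensors
import HarnessLib

/-!
# Re-indexing the chunks and terms of an interface tensor, and splitting its parameter list
(Vassilevska Williams–Xu–Xu–Zhou 2024, Def. 4.1 and §6 "assume without loss of generality that we are
left with the first `s'` terms") — proved

Topic `Literature/Computability/AlgebraicComplexity`.  An interface tensor `𝒯_{τ,L,ε}` (Def. 4.1 of
Vassilevska Williams–Xu–Xu–Zhou, *New bounds for matrix multiplication: from alpha to omega*, SODA 2024,
arXiv:2307.07970) is `⊗_t T_{i_t,j_t,k_t}^{⊗n_t}[…]`: it does not depend on the order of the terms nor on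
the position of the chunks.  §6 uses this twice: "we assume that we already used Thm. 6.1 to handle
terms with `i_t = 0`, `j_t = 0` or `k_t = 0`, and assume without loss of generality that we are left
with the first `s'` terms", and Def. 4.1's remark "the tensor product of two … interface tensors is also
a[n] … interface tensor, whose parameter list is the concatenation".  This file proves:

* `completeSplitOn_comp_equiv`, `mem_admissibleSeqs_reindex`, `interfaceTensor_reindex` — **along a
  bijection `φ` of chunks and `ψ` of terms with `τ ∘ φ = ψ ∘ τ'`, `𝒯_{τ',L∘ψ,ε}(x∘φ, y∘φ, z∘φ) =
  𝒯_{τ,L,ε}(x,y,z)`**, whence restrictions both ways (`tensorRestrictsTo_interfaceTensor_reindex`,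
  `…_reindex'`: the two tensors are isomorphic);
* `splitTermEquiv`, `splitChunkEquiv`, `splitTermMapIn/Out`, `splitListIn/Out` — for a decidable
  predicate `P` on terms, the re-indexing that lists the `P`-terms (and their chunks) first;
* `vxxz2024_interfaceTensor_split` — **`𝒯_{τ,L,ε} ≅ 𝒯_{τ_P ⧺ τ_{¬P}, L_P ⧺ L_{¬P}, ε}`** and, with the
  landed concatenation isomorphism, **`𝒯_{τ,L,ε} ≅ 𝒯_{τ_P,L_P,ε} ⊗ 𝒯_{τ_{¬P},L_{¬P},ε}`**
  (`vxxz2024_interfaceTensor_split_kronecker`) — e.g. `P t = (i_t = 0 ∨ j_t = 0 ∨ k_t = 0)` separates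
  the matrix multiplication terms (Thm. 6.1) from the terms of Prop. 6.2 / Thm. 6.3.

Everything is proved; the definitions are the four re-indexing maps; no named facts.

## References

* V. Vassilevska Williams, Y. Xu, Z. Xu, R. Zhou, *New bounds for matrix multiplication: from alpha
  to omega*, SODA 2024, arXiv:2307.07970 (held: `paper:arxiv-2307.07970`), Def. 4.1 (and the remark
  after it), §6 (second paragraph after Thm. 6.1). [VassilevskaWilliamsXuXuZhou2024]
-/

noncomputable section

open scoped BigOperators
open Finset

namespace Literature.Computability.AlgebraicComplexity

open Literature.Barriers.MatrixMultiplication (bigCwTensor)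

universe u

/-! ## Re-indexing chunks and terms -/

section Reindex

variable {c n n' s s' : ℕ}

/-- Complete split distributions are invariant under a bijective re-indexing of the positions. [cite: VassilevskaWilliamsXuXuZhou2024, Def. 3.5] -/
theorem completeSplitOn_comp_equiv (I : Fin n → Fin c → Fin 3) (φ : Fin n' ≃ Fin n) (S : Finset (Fin n)) :
    completeSplitOn (fun u' => I (φ u')) (S.map φ.symm.toEmbedding) = completeSplitOn I S := by
  funext σ
  have h1 : ((S.map φ.symm.toEmbedding).filter fun u' => I (φ u') = σ) = (S.filter fun u => I u = σ).map φ.symm.toEmbedding := by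
    ext u'
    simp only [mem_filter, mem_map_equiv, Equiv.symm_symm]
  simp only [completeSplitOn, h1, card_map]

variable (τ : Fin n → Fin s) (τ' : Fin n' → Fin s') (φ : Fin n' ≃ Fin n) (ψ : Fin s' ≃ Fin s)

/-- The fibres of the re-indexed term map are the re-indexed fibres. [folklore] -/
theorem termFibre_reindex (hτ : ∀ u', τ (φ u') = ψ (τ' u')) (t' : Fin s') :
    (univ.filter fun u' => τ' u' = t') = (univ.filter fun u => τ u = ψ t').map φ.symm.toEmbedding := by
  ext u'
  simp only [mem_filter, mem_univ, true_and, mem_map_equiv, Equiv.symm_symm, hτ u', ψ.injective.eq_iff]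

/-- **Admissibility is invariant under re-indexing** chunks (`φ`) and terms (`ψ`, with the degrees and
distributions transported). [cite: VassilevskaWilliamsXuXuZhou2024, Def. 4.1] -/
theorem mem_admissibleSeqs_reindex (hτ : ∀ u', τ (φ u') = ψ (τ' u')) (deg : Fin s → ℕ) (γ : Fin s → (Fin c → Fin 3) → ℝ)
    (ε : ℝ) (I : Fin n → Fin c → Fin 3) :
    (fun u' => I (φ u')) ∈ admissibleSeqs τ' (fun t' => deg (ψ t')) (fun t' => γ (ψ t')) ε ↔ I ∈ admissibleSeqs τ deg γ ε := by
  rw [mem_admissibleSeqs, mem_admissibleSeqs]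
  refine and_congr ?_ ?_
  · constructor
    · intro h u
      have := h (φ.symm u)
      rw [Equiv.apply_symm_apply, ← hτ, Equiv.apply_symm_apply] at this
      exact this
    · intro h u'
      rw [← hτ u']
      exact h (φ u')
  · have key : ∀ t', ((univ.filter fun u' => τ' u' = t').Nonempty →
          SplitConsistentOn ε (γ (ψ t')) (fun u' => I (φ u')) (univ.filter fun u' => τ' u' = t')) ↔
        ((univ.filter fun u => τ u = ψ t').Nonempty → SplitConsistentOn ε (γ (ψ t')) I (univ.filter fun u => τ u = ψ t')) := by
      intro t'
      rw [termFibre_reindex τ τ' φ ψ hτ t', map_nonempty]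
      unfold SplitConsistentOn
      simp only [completeSplitOn_comp_equiv]
    constructor
    · intro h t hne
      have ht := (key (ψ.symm t)).1 (h (ψ.symm t))
      rw [Equiv.apply_symm_apply] at ht
      exact ht hne
    · intro h t'
      exact (key t').2 (h (ψ t'))

variable (K : Type u) [CommSemiring K] (q : ℕ)

/-- **`𝒯_{τ', L∘ψ, ε}(x∘φ, y∘φ, z∘φ) = 𝒯_{τ,L,ε}(x, y, z)`**: an interface tensor does not depend on the
order of its terms nor on the positions of the chunks. [cite: VassilevskaWilliamsXuXuZhou2024, Def. 4.1] -/
theorem interfaceTensor_reindex (hτ : ∀ u', τ (φ u') = ψ (τ' u')) (L : Fin s → InterfaceTerm c) (ε : ℝ)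
    (x y z : Fin n → Fin c → Fin (q + 2)) :
    interfaceTensor K q τ' (fun t' => L (ψ t')) ε (fun u' => x (φ u')) (fun u' => y (φ u')) (fun u' => z (φ u')) =
      interfaceTensor K q τ L ε x y z := by
  have hX : levelSeq (fun u' => x (φ u')) ∈ levelBlocksX τ' (fun t' => L (ψ t')) ε ↔ levelSeq x ∈ levelBlocksX τ L ε :=
    mem_admissibleSeqs_reindex τ τ' φ ψ hτ (fun t => (L t).i) (fun t => (L t).γX) ε (levelSeq x)
  have hY : levelSeq (fun u' => y (φ u')) ∈ levelBlocksY τ' (fun t' => L (ψ t')) ε ↔ levelSeq y ∈ levelBlocksY τ L ε :=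
    mem_admissibleSeqs_reindex τ τ' φ ψ hτ (fun t => (L t).j) (fun t => (L t).γY) ε (levelSeq y)
  have hZ : levelSeq (fun u' => z (φ u')) ∈ levelBlocksZ τ' (fun t' => L (ψ t')) ε ↔ levelSeq z ∈ levelBlocksZ τ L ε :=
    mem_admissibleSeqs_reindex τ τ' φ ψ hτ (fun t => (L t).k) (fun t => (L t).γZ) ε (levelSeq z)
  rw [interfaceTensor_apply, interfaceTensor_apply]
  simp only [hX, hY, hZ]
  split_ifs
  · exact Fintype.prod_equiv φ _ _ fun u' => rfl
  · rfl

/-- **`𝒯_{τ,L,ε} ≥ 𝒯_{τ',L∘ψ,ε}`** (re-indexing). [cite: VassilevskaWilliamsXuXuZhou2024, Def. 4.1] -/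
theorem tensorRestrictsTo_interfaceTensor_reindex (hτ : ∀ u', τ (φ u') = ψ (τ' u')) (L : Fin s → InterfaceTerm c) (ε : ℝ) :
    TensorRestrictsTo (interfaceTensor K q τ L ε) (interfaceTensor K q τ' (fun t' => L (ψ t')) ε) := by
  have key : interfaceTensor K q τ' (fun t' => L (ψ t')) ε = fun x' y' z' =>
      interfaceTensor K q τ L ε (fun u => x' (φ.symm u)) (fun u => y' (φ.symm u)) (fun u => z' (φ.symm u)) := by
    funext x' y' z'
    rw [← interfaceTensor_reindex τ τ' φ ψ K q hτ L ε]
    simp only [Equiv.symm_apply_apply]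
  rw [key]
  exact TensorRestrictsTo.comap _ _ _ _

/-- **`𝒯_{τ',L∘ψ,ε} ≥ 𝒯_{τ,L,ε}`** (re-indexing back): the two are isomorphic. [cite: VassilevskaWilliamsXuXuZhou2024, Def. 4.1] -/
theorem tensorRestrictsTo_interfaceTensor_reindex' (hτ : ∀ u', τ (φ u') = ψ (τ' u')) (L : Fin s → InterfaceTerm c) (ε : ℝ) :
    TensorRestrictsTo (interfaceTensor K q τ' (fun t' => L (ψ t')) ε) (interfaceTensor K q τ L ε) := by
  have key : interfaceTensor K q τ L ε = fun x y z =>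
      interfaceTensor K q τ' (fun t' => L (ψ t')) ε (fun u' => x (φ u')) (fun u' => y (φ u')) (fun u' => z (φ u')) := by
    funext x y z
    rw [interfaceTensor_reindex τ τ' φ ψ K q hτ L ε]
  rw [key]
  exact TensorRestrictsTo.comap _ _ _ _

end Reindex

/-! ## Listing the terms with a property first -/

section Split

variable {c n s : ℕ} (τ : Fin n → Fin s) (P : Fin s → Prop) [DecidablePred P]

/-- The term re-indexing listing the `P`-terms first: `Fin (#P + #¬P) ≃ Fin s`. [folklore] -/
def splitTermEquiv : Fin (Fintype.card {t // P t} + Fintype.card {t // ¬ P t}) ≃ Fin s :=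
  finSumFinEquiv.symm.trans
    (((Fintype.equivFin {t // P t}).symm.sumCongr (Fintype.equivFin {t // ¬ P t}).symm).trans (Equiv.sumCompl P))

/-- The chunk re-indexing listing the chunks of the `P`-terms first. [folklore] -/
def splitChunkEquiv : Fin (Fintype.card {u // P (τ u)} + Fintype.card {u // ¬ P (τ u)}) ≃ Fin n :=
  finSumFinEquiv.symm.trans
    (((Fintype.equivFin {u // P (τ u)}).symm.sumCongr (Fintype.equivFin {u // ¬ P (τ u)}).symm).trans
      (Equiv.sumCompl fun u => P (τ u)))

/-- The term re-indexing on the first summand. [folklore] -/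
@[simp] theorem splitTermEquiv_castAdd (a : Fin (Fintype.card {t // P t})) :
    splitTermEquiv P (Fin.castAdd _ a) = ((Fintype.equivFin {t // P t}).symm a).1 := by
  simp [splitTermEquiv]

/-- The term re-indexing on the second summand. [folklore] -/
@[simp] theorem splitTermEquiv_natAdd (b : Fin (Fintype.card {t // ¬ P t})) :
    splitTermEquiv P (Fin.natAdd _ b) = ((Fintype.equivFin {t // ¬ P t}).symm b).1 := by
  simp [splitTermEquiv]

/-- The chunk re-indexing on the first summand. [folklore] -/
@[simp] theorem splitChunkEquiv_castAdd (a : Fin (Fintype.card {u // P (τ u)})) :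
    splitChunkEquiv τ P (Fin.castAdd _ a) = ((Fintype.equivFin {u // P (τ u)}).symm a).1 := by
  simp [splitChunkEquiv]

/-- The chunk re-indexing on the second summand. [folklore] -/
@[simp] theorem splitChunkEquiv_natAdd (b : Fin (Fintype.card {u // ¬ P (τ u)})) :
    splitChunkEquiv τ P (Fin.natAdd _ b) = ((Fintype.equivFin {u // ¬ P (τ u)}).symm b).1 := by
  simp [splitChunkEquiv]

/-- The term map of the chunks of the `P`-terms. [folklore] -/
def splitTermMapIn : Fin (Fintype.card {u // P (τ u)}) → Fin (Fintype.card {t // P t}) := fun a =>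
  Fintype.equivFin {t // P t} ⟨τ ((Fintype.equivFin {u // P (τ u)}).symm a).1, ((Fintype.equivFin {u // P (τ u)}).symm a).2⟩

/-- The term map of the chunks of the other terms. [folklore] -/
def splitTermMapOut : Fin (Fintype.card {u // ¬ P (τ u)}) → Fin (Fintype.card {t // ¬ P t}) := fun b =>
  Fintype.equivFin {t // ¬ P t} ⟨τ ((Fintype.equivFin {u // ¬ P (τ u)}).symm b).1, ((Fintype.equivFin {u // ¬ P (τ u)}).symm b).2⟩

variable (L : Fin s → InterfaceTerm c)

/-- The parameter list of the `P`-terms. [folklore] -/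
def splitListIn : Fin (Fintype.card {t // P t}) → InterfaceTerm c := fun a => L ((Fintype.equivFin {t // P t}).symm a).1

/-- The parameter list of the other terms. [folklore] -/
def splitListOut : Fin (Fintype.card {t // ¬ P t}) → InterfaceTerm c := fun b => L ((Fintype.equivFin {t // ¬ P t}).symm b).1

/-- The re-indexed term map is the concatenation of the two term maps. [folklore] -/
theorem splitChunkEquiv_compat (u' : Fin (Fintype.card {u // P (τ u)} + Fintype.card {u // ¬ P (τ u)})) :
    τ (splitChunkEquiv τ P u') = splitTermEquiv P (concatTermMap (splitTermMapIn τ P) (splitTermMapOut τ P) u') := by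
  refine Fin.addCases (fun a => ?_) (fun b => ?_) u'
  · rw [splitChunkEquiv_castAdd, concatTermMap_castAdd, splitTermEquiv_castAdd, splitTermMapIn, Equiv.symm_apply_apply]
  · rw [splitChunkEquiv_natAdd, concatTermMap_natAdd, splitTermEquiv_natAdd, splitTermMapOut, Equiv.symm_apply_apply]

/-- The re-indexed parameter list is the concatenation of the two lists. [folklore] -/
theorem splitList_eq : (fun t' => L (splitTermEquiv P t')) = Fin.append (splitListIn P L) (splitListOut P L) := by
  funext t'
  refine Fin.addCases (fun a => ?_) (fun b => ?_) t'
  · rw [Fin.append_left, splitTermEquiv_castAdd]; rfl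
  · rw [Fin.append_right, splitTermEquiv_natAdd]; rfl

variable (K : Type u) [CommSemiring K] (q : ℕ)

/-- **`𝒯_{τ,L,ε} ≅ 𝒯_{τ_P ⧺ τ_{¬P}, L_P ⧺ L_{¬P}, ε}`**: the terms with property `P` may be listed first
("assume without loss of generality that we are left with the first `s'` terms"). [cite: VassilevskaWilliamsXuXuZhou2024, §6 (paragraph after Thm. 6.1) and Def. 4.1] -/
theorem vxxz2024_interfaceTensor_split (ε : ℝ) :
    TensorRestrictsTo (interfaceTensor K q τ L ε)
        (interfaceTensor K q (concatTermMap (splitTermMapIn τ P) (splitTermMapOut τ P)) (Fin.append (splitListIn P L) (splitListOut P L)) ε) ∧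
      TensorRestrictsTo
        (interfaceTensor K q (concatTermMap (splitTermMapIn τ P) (splitTermMapOut τ P)) (Fin.append (splitListIn P L) (splitListOut P L)) ε)
        (interfaceTensor K q τ L ε) := by
  rw [← splitList_eq P L]
  exact ⟨tensorRestrictsTo_interfaceTensor_reindex τ _ (splitChunkEquiv τ P) (splitTermEquiv P) K q (splitChunkEquiv_compat τ P) L ε,
    tensorRestrictsTo_interfaceTensor_reindex' τ _ (splitChunkEquiv τ P) (splitTermEquiv P) K q (splitChunkEquiv_compat τ P) L ε⟩

/-- **`𝒯_{τ,L,ε} ≅ 𝒯_{τ_P,L_P,ε} ⊗ 𝒯_{τ_{¬P},L_{¬P},ε}`** — the interface tensor is the tensor product of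
the interface tensor of its `P`-terms and that of its other terms. [cite: VassilevskaWilliamsXuXuZhou2024, Def. 4.1 (remark: concatenation of parameter lists) and §6] -/
theorem vxxz2024_interfaceTensor_split_kronecker (ε : ℝ) :
    TensorRestrictsTo (interfaceTensor K q τ L ε)
        (kroneckerTensor (interfaceTensor K q (splitTermMapIn τ P) (splitListIn P L) ε)
          (interfaceTensor K q (splitTermMapOut τ P) (splitListOut P L) ε)) ∧
      TensorRestrictsTo
        (kroneckerTensor (interfaceTensor K q (splitTermMapIn τ P) (splitListIn P L) ε)
          (interfaceTensor K q (splitTermMapOut τ P) (splitListOut P L) ε))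
        (interfaceTensor K q τ L ε) := by
  obtain ⟨h₁, h₂⟩ := vxxz2024_interfaceTensor_split τ P L K q ε
  exact ⟨h₁.trans (tensorRestrictsTo_interfaceTensor_concat_kronecker K q _ _ _ _ ε),
    (tensorRestrictsTo_kronecker_interfaceTensor_concat K q _ _ _ _ ε).trans h₂⟩

end Split

end Literature.Computability.AlgebraicComplexity
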